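import Literature.Topology.FourManifolds.CurveFamilyIsotopy
import Literature.Topology.FourManifolds.LinkTubularUntwist
import HarnessLib

/-!
# Normalising the band end: smooth functions on the circle from window functions

Topic `Literature/Topology/FourManifolds`; fact seat `provefact-IsStrictHandleSlide.isSurgery`
(Kirby (1989), Ch. I §4; remaining content: the named fact (S)
`Literature.Topology.FourManifolds.FramedLink.IsStrictHandleSlide.slideModel`). The rotation
angle of the tube about the push-off circle is prescribed along the attaching arc, as a function
`g` of the parameter `s` of `Kⱼ' ∘ circlePt` supported in a window of length `< 1`; this file turns
such a `g` into a smooth function on the circle (theorems only, no definitions, no named facts):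

* `Literature.Topology.FourManifolds.SlideSweep.exists_contMDiff_circle_of_window` — if
  `g : ℝ → ℝ` is `C^∞` and vanishes outside `[a + ε, a + 1 - ε]` for some `ε > 0`, there is a
  `C^∞` function `β : S¹ → ℝ` with `β (circlePt s) = g s` for all `s ∈ [a, a + 1]` and, more
  generally, `β (circlePt s) = periodise a g s` for all `s` (the `1`-periodisation of
  `CurveFamilyIsotopy.lean`, smooth by `contDiff_periodise`, descended to the circle by
  `exists_contMDiff_comp_circlePoint_eq` of `LinkTubularUntwist.lean`).

## References

* R. C. Kirby, *The Topology of 4-Manifolds*, LNM 1374, Springer (1989), Ch. I §4. [Kirby1989]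
-/

open scoped Manifold ContDiff Topology
open Function Set Metric Real

noncomputable section

namespace Literature.Topology.FourManifolds

namespace SlideSweep

/-- **A window function descends to a smooth function on the circle.** See the module docstring.
[folklore] -/
theorem exists_contMDiff_circle_of_window {g : ℝ → ℝ} (hg : ContDiff ℝ ∞ g) {a ε : ℝ} (hε : 0 < ε)
    (hg0 : ∀ s, s ∉ Icc (a + ε) (a + 1 - ε) → g s = 0) :
    ∃ β : Metric.sphere (0 : EuclideanSpace ℝ (Fin 2)) 1 → ℝ,
      ContMDiff (𝓡 1) 𝓘(ℝ, ℝ) ∞ β ∧ (∀ s, β (circlePt s) = periodise a g s) ∧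
      ∀ s ∈ Icc a (a + 1), β (circlePt s) = g s := by
  -- the seam condition: `g (t + 1) = g t (= 0)` for `t` near `a`
  have hseam : ∀ t ∈ Ioo (a - ε) (a + ε), g (t + 1) = g t := by
    intro t ht
    rw [hg0 t (fun h ↦ by linarith [h.1, ht.2]), hg0 (t + 1) (fun h ↦ by linarith [h.2, ht.1])]
  have hper : ContDiff ℝ ∞ (periodise a g) := contDiff_periodise hg hε hseam
  -- rescale to a `2π`-periodic function of the angle
  set P : ℝ → ℝ := fun φ ↦ periodise a g (φ / (2 * π)) with hP
  have hPs : ContDiff ℝ ∞ P := hper.comp (contDiff_id.div_const _)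
  have hPp : Periodic P (2 * π) := fun φ ↦ by
    simp only [hP]
    rw [add_div, div_self (by positivity : (2 * π : ℝ) ≠ 0)]
    exact periodic_periodise a g _
  obtain ⟨β, hβ, hβP⟩ := exists_contMDiff_comp_circlePoint_eq hPp hPs
  have hβs : ∀ s, β (circlePt s) = periodise a g s := fun s ↦ by
    rw [circlePt_eq_circlePoint, hβP]
    simp only [hP]
    congr 1
    field_simp
  refine ⟨β, hβ, hβs, fun s hs ↦ ?_⟩
  rw [hβs]
  rcases hs.2.eq_or_lt with h1 | h1
  · -- `s = a + 1`: both sides vanish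
    rw [h1, show a + 1 = a + ((1 : ℤ) : ℝ) by simp, periodise_add_int, periodise_eq_self a g ⟨le_rfl, by simp⟩,
      hg0 a (fun h ↦ by linarith [h.1]), hg0 _ (fun h ↦ by push_cast at h; linarith [h.2])]
  · exact periodise_eq_self a g ⟨hs.1, h1⟩

end SlideSweep

end Literature.Topology.FourManifolds
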